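import Summits.ResolutionOfSingularities.ResolutionOfSingularities.Theorems.FrobeniusLadderFRationalResolutionStratumDescentPrime
import Summits.ResolutionOfSingularities.ResolutionOfSingularities.Theorems.FrobeniusLadderFRationalResolutionLocalizationQuotientTransport
import HarnessLib

/-!
# Crux `FrobeniusLadder.FRationalResolution` (stmt-ResolutionOfSingularities-15317), line `redirect`,
# stub `stub_diagonalizableQuotientResolution` — step (e-asm), end: regularity of the stratum
# `S_𝔔'/(x_I)` DESCENDS to the degree-zero local ring `(S₀)_{𝔔' ∩ S₀}` modulo the `e`-saturated
# contraction of `(x_I)` (memo MEMO-15317-leafhand2-g3 §6–§7)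

Composition of `…StratumDescentPrime` (model `R₀ = (S₀)[e⁻¹]`, `L = S[e⁻¹]`) with
`…LocalizationQuotientTransport`: for a prime `𝔔'` of `S` avoiding `e` and containing `x_I`, if
`S_𝔔'/(x_I)S_𝔔'` is a regular local ring then so is `(S₀)_𝔮' ⧸ J' (S₀)_𝔮'`, where `𝔮' = 𝔔' ∩ S₀` and
`J' = ((x_I) S[e⁻¹]) ∩ S₀` is the `e`-saturation of `(x_I)S ∩ S₀` (equal to it, and to Kato's ideal,
after localising at `𝔮'` — `…FixedPointContraction`; that last rewriting is left to the packaging step).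

* `isRegularLocalRing_congr_atPrime_quotient`, `isRegularLocalRing_congr_atPrime_map_mk` —
  transports along an equality of primes;
* `isRegularLocalRing_atPrime_map_mk_of_localization` — generic: regularity of `(R_M/J)` at `q₀/J`
  gives regularity of `R/J'` at `𝔮/J'` (`J' = J ∩ R`, `𝔮 = q₀ ∩ R`), phrased on `Spec (R/J')` to keep
  typeclass paths unique on grade-zero subtypes;
* **`isRegularLocalRing_model_quotient_of_stratum`** — the statement above on an ABSTRACT model
  `R₀` of `(S₀)_e` (quotients of `↥(𝒮 0)` or of `Localization.Away e` over it cannot be written in a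
  statement without defeating typeclass synthesis — checked; keep `R₀` abstract and instantiate inside
  proofs); `isPrime_map_and_le`, `comap_model_eq` — the bookkeeping identities `q₀ ∩ S₀ = 𝔔' ∩ S₀`,
  `J ∩ S₀ = (x_I)L ∩ S₀` needed to read the conclusion in `(S₀)_{𝔔' ∩ S₀}` via
  `isRegularLocalRing_atPrime_map_mk_of_localization` (inside the `IsLogRegularAt` packaging).

Honest label: assembly brick (no stub closed). No definitions, no named facts, no sorry.
[cite: Matsumura1987, Thm. 23.7 (i)] [folklore; cite: Kato1994, Prop. (7.1)]
-/

noncomputable section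

-- single-problem summit: the doubled namespace component is forced
set_option linter.dupNamespace false

open DirectSum Literature.RingTheory.GradedAlgebra
open Literature.AlgebraicGeometry.Resolution.DiagonalizableQuotient

namespace Summit.ResolutionOfSingularities.ResolutionOfSingularities.Theorems.FRationalResolution.StratumDescentGradeZero

universe u w

/-- Transport of "`R_𝔮 ⧸ J R_𝔮` is regular" along an equality of primes. [folklore] -/
theorem isRegularLocalRing_congr_atPrime_quotient {R : Type u} [CommRing R] {𝔮₁ 𝔮₂ : Ideal R}
    [𝔮₁.IsPrime] [𝔮₂.IsPrime] (h : 𝔮₁ = 𝔮₂) (J : Ideal R)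
    (h₁ : IsRegularLocalRing (Localization.AtPrime 𝔮₁ ⧸ J.map (algebraMap R (Localization.AtPrime 𝔮₁)))) :
    IsRegularLocalRing (Localization.AtPrime 𝔮₂ ⧸ J.map (algebraMap R (Localization.AtPrime 𝔮₂))) := by
  subst h
  exact h₁

/-- Transport of "`(R/J)_{𝔮/J}` is regular" along an equality of primes. [folklore] -/
theorem isRegularLocalRing_congr_atPrime_map_mk {R : Type u} [CommRing R] {𝔮₁ 𝔮₂ : Ideal R}
    [𝔮₁.IsPrime] [𝔮₂.IsPrime] (h : 𝔮₁ = 𝔮₂) (J : Ideal R) (hJ : J ≤ 𝔮₁)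
    (h₁ : haveI : (𝔮₁.map (Ideal.Quotient.mk J)).IsPrime := Ideal.isPrime_map_quotientMk_of_isPrime hJ
      IsRegularLocalRing (Localization.AtPrime (𝔮₁.map (Ideal.Quotient.mk J)))) :
    haveI : (𝔮₂.map (Ideal.Quotient.mk J)).IsPrime := Ideal.isPrime_map_quotientMk_of_isPrime (h ▸ hJ)
    IsRegularLocalRing (Localization.AtPrime (𝔮₂.map (Ideal.Quotient.mk J))) := by
  subst h
  exact h₁

/-- **Regularity of `(R_M/J)` at `q₀/J` gives regularity of `(R/J')` at `𝔮/J'`** (`R_M` a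
localization, `J' = J ∩ R`, `𝔮 = q₀ ∩ R`): `…LocalizationQuotientTransport` followed by
`R_𝔮/J'R_𝔮 ≅ (R/J')_{𝔮/J'}`. [folklore] -/
theorem isRegularLocalRing_atPrime_map_mk_of_localization {R : Type u} [CommRing R]
    (M : Submonoid R) (J q₀ : Ideal (Localization M)) [q₀.IsPrime] (hJq : J ≤ q₀)
    (h : haveI : (q₀.map (Ideal.Quotient.mk J)).IsPrime := Ideal.isPrime_map_quotientMk_of_isPrime hJq
      IsRegularLocalRing (Localization.AtPrime (q₀.map (Ideal.Quotient.mk J)))) :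
    haveI : ((q₀.comap (algebraMap R (Localization M))).map (Ideal.Quotient.mk
        (J.comap (algebraMap R (Localization M))))).IsPrime :=
      Ideal.isPrime_map_quotientMk_of_isPrime (Ideal.comap_mono hJq)
    IsRegularLocalRing (Localization.AtPrime ((q₀.comap (algebraMap R (Localization M))).map
      (Ideal.Quotient.mk (J.comap (algebraMap R (Localization M)))))) := by
  haveI : ((q₀.comap (algebraMap R (Localization M))).map (Ideal.Quotient.mk
      (J.comap (algebraMap R (Localization M))))).IsPrime :=
    Ideal.isPrime_map_quotientMk_of_isPrime (Ideal.comap_mono hJq)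
  have h1 := LocalizationQuotientTransport.isRegularLocalRing_atPrime_quotient_of_localization
    M J q₀ hJq h
  exact (Literature.AlgebraicGeometry.Resolution.isRegularLocalRing_localization_quotient_iff
    (J.comap (algebraMap R (Localization M))) (q₀.comap (algebraMap R (Localization M)))
    (Ideal.comap_mono hJq)).mp h1

variable {k : Type u} [Field k] {A : Type w} [DecidableEq A] [AddCommGroup A] {S : Type u}
  [CommRing S] [Algebra k S] (𝒮 : A → Submodule k S) [GradedAlgebra 𝒮]
  {n : ℕ} (x : Fin n → S) (a : Fin n → A) (hx : ∀ i, x i ∈ 𝒮 (a i))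

include hx in
/-- **Regularity of a stratum descends to the degree-zero MODEL, from the `S`-side hypothesis.** `S`
Noetherian of finite type over a field, torsion grading, `x` homogeneous, `I ⊆ {1..n}`,
`g • S ⊆ S₀[x]`, `e ∈ S₀` with `g ∣ e` and `x_j ∣ e` for `j ∉ I`; `L` a localization of `S` at the
powers of `e`, `R₀` a Noetherian model of `(S₀)_e` mapping to `L` compatibly. Let `𝔔'` be a prime of
`S` with `e ∉ 𝔔'`, `(x_I)L ⊆ 𝔔'L`, and `S_𝔔'/(x_I)S_𝔔'` regular. Then with `𝔓 = 𝔔' L`, `q₀ = 𝔓 ∩ R₀`,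
`J = (x_I)L ∩ R₀`: the local ring of `R₀/J` at `q₀/J` is regular. (Use with
`comap_model_prime_eq` / `comap_model_ideal_eq` and the generic
`isRegularLocalRing_atPrime_map_mk_of_localization` to land in `(S₀)_{𝔔' ∩ S₀}`.)
[cite: Matsumura1987, Thm. 23.7 (i)] [folklore; cite: Kato1994, Prop. (7.1)] -/
theorem isRegularLocalRing_model_quotient_of_stratum [IsNoetherianRing S] [Algebra.FiniteType k S]
    (I : Finset (Fin n)) (g : 𝒮 0)
    (hgen : ∀ s : S, (g : S) * s ∈ Algebra.adjoin (𝒮 0) (Set.range x)) (e : 𝒮 0)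
    (hge : (g : S) ∣ (e : S)) (hxe : ∀ j ∉ I, x j ∣ (e : S))
    (L : Type u) [CommRing L] [Algebra S L] [Algebra k L] [IsScalarTower k S L]
    [IsLocalization (Submonoid.powers (e : S)) L]
    (R₀ : Type u) [CommRing R₀] [IsNoetherianRing R₀] [Algebra (𝒮 0) R₀] [IsLocalization.Away e R₀]
    [Algebra R₀ L] (hcomm : ∀ c : 𝒮 0, algebraMap R₀ L (algebraMap (𝒮 0) R₀ c) = algebraMap S L (c : S))
    (𝔔' : Ideal S) [𝔔'.IsPrime] (he𝔔 : (e : S) ∉ 𝔔')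
    (hreg : IsRegularLocalRing (Localization.AtPrime 𝔔' ⧸
      (Ideal.span (x '' (↑I : Set (Fin n)))).map (algebraMap S (Localization.AtPrime 𝔔'))))
    [h𝔓 : (𝔔'.map (algebraMap S L)).IsPrime]
    (hI𝔓 : (Ideal.span (x '' (↑I : Set (Fin n)))).map (algebraMap S L) ≤ 𝔔'.map (algebraMap S L)) :
    haveI : (((𝔔'.map (algebraMap S L)).comap (algebraMap R₀ L)).map (Ideal.Quotient.mk
        (((Ideal.span (x '' (↑I : Set (Fin n)))).map (algebraMap S L)).comap (algebraMap R₀ L)))).IsPrime :=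
      Ideal.isPrime_map_quotientMk_of_isPrime (Ideal.comap_mono hI𝔓)
    IsRegularLocalRing (Localization.AtPrime
      (((𝔔'.map (algebraMap S L)).comap (algebraMap R₀ L)).map (Ideal.Quotient.mk
        (((Ideal.span (x '' (↑I : Set (Fin n)))).map (algebraMap S L)).comap (algebraMap R₀ L))))) := by
  classical
  set IS : Ideal S := Ideal.span (x '' (↑I : Set (Fin n))) with hIS
  set IL : Ideal L := IS.map (algebraMap S L) with hIL
  set 𝔓 : Ideal L := 𝔔'.map (algebraMap S L) with h𝔓def
  have hdisj : Disjoint (↑(Submonoid.powers (e : S)) : Set S) (𝔔' : Set S) := by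
    rw [Set.disjoint_left]
    rintro _ ⟨m, rfl⟩ hm
    exact he𝔔 (‹𝔔'.IsPrime›.mem_of_pow_mem m hm)
  have h𝔔𝔓 : 𝔔' = 𝔓.comap (algebraMap S L) := by
    rw [h𝔓def, ← Ideal.under_def,
      IsLocalization.under_map_of_isPrime_disjoint (Submonoid.powers (e : S)) L ‹𝔔'.IsPrime› hdisj]
  -- `(L/IL)_{𝔓̄}` is regular: it is `S_𝔔' ⧸ (x_I)` localised
  haveI : (𝔓.map (Ideal.Quotient.mk IL)).IsPrime := Ideal.isPrime_map_quotientMk_of_isPrime hI𝔓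
  have hregL : IsRegularLocalRing (Localization.AtPrime (𝔓.map (Ideal.Quotient.mk IL))) := by
    have hreg' := isRegularLocalRing_congr_atPrime_quotient h𝔔𝔓 IS hreg
    haveI : IsLocalization.AtPrime (Localization.AtPrime 𝔓) (𝔓.comap (algebraMap S L)) :=
      IsLocalization.isLocalization_isLocalization_atPrime_isLocalization
        (Submonoid.powers (e : S)) (Localization.AtPrime 𝔓) 𝔓
    let ψ : Localization.AtPrime (𝔓.comap (algebraMap S L)) ≃ₐ[S] Localization.AtPrime 𝔓 :=
      IsLocalization.algEquiv (𝔓.comap (algebraMap S L)).primeCompl _ _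
    have hideal : IL.map (algebraMap L (Localization.AtPrime 𝔓)) =
        (IS.map (algebraMap S (Localization.AtPrime (𝔓.comap (algebraMap S L))))).map
          (ψ : Localization.AtPrime (𝔓.comap (algebraMap S L)) →+* Localization.AtPrime 𝔓) := by
      rw [hIL, Ideal.map_map, Ideal.map_map, ← IsScalarTower.algebraMap_eq]
      congr 1
      ext r
      simp
    have h1 : IsRegularLocalRing (Localization.AtPrime 𝔓 ⧸
        IL.map (algebraMap L (Localization.AtPrime 𝔓))) := by
      let θ := Ideal.quotientEquiv (IS.map (algebraMap S (Localization.AtPrime (𝔓.comap (algebraMap S L)))))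
        (IL.map (algebraMap L (Localization.AtPrime 𝔓)))
        (ψ : Localization.AtPrime (𝔓.comap (algebraMap S L)) ≃+* Localization.AtPrime 𝔓)
        (by rw [hideal]; rfl)
      haveI := hreg'
      exact IsRegularLocalRing.of_ringEquiv
        (R := Localization.AtPrime (𝔓.comap (algebraMap S L)) ⧸
          IS.map (algebraMap S (Localization.AtPrime (𝔓.comap (algebraMap S L))))) θ
    exact (Literature.AlgebraicGeometry.Resolution.isRegularLocalRing_localization_quotient_iff
      IL 𝔓 hI𝔓).mp h1
  exact StratumDescentPrime.isRegularLocalRing_quotient_atPrime_of_stratum 𝒮 x a hx e L R₀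
    hcomm I g hgen hge hxe 𝔓 hI𝔓 hregL

/-- `𝔔'L` is prime and contains `(x_I)L` under the hypotheses above (helper for the instance
arguments of `isRegularLocalRing_model_quotient_of_stratum`). [folklore] -/
theorem isPrime_map_and_le {e : S} (L : Type u) [CommRing L] [Algebra S L]
    [IsLocalization (Submonoid.powers e) L] (IS : Ideal S)
    (𝔔' : Ideal S) [𝔔'.IsPrime] (he𝔔 : e ∉ 𝔔') (hIS : IS ≤ 𝔔') :
    (𝔔'.map (algebraMap S L)).IsPrime ∧ IS.map (algebraMap S L) ≤ 𝔔'.map (algebraMap S L) ∧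
      (𝔔'.map (algebraMap S L)).comap (algebraMap S L) = 𝔔' := by
  have hdisj : Disjoint (↑(Submonoid.powers e) : Set S) (𝔔' : Set S) := by
    rw [Set.disjoint_left]
    rintro _ ⟨m, rfl⟩ hm
    exact he𝔔 (‹𝔔'.IsPrime›.mem_of_pow_mem m hm)
  refine ⟨IsLocalization.isPrime_of_isPrime_disjoint (Submonoid.powers e) L 𝔔' ‹_› hdisj,
    Ideal.map_mono hIS, ?_⟩
  rw [← Ideal.under_def]
  exact IsLocalization.under_map_of_isPrime_disjoint (Submonoid.powers e) L ‹𝔔'.IsPrime› hdisj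

/-- **The model's prime and ideal contract to the expected ideals of `S₀`**: with the notation of
`isRegularLocalRing_model_quotient_of_stratum`, `q₀ ∩ S₀ = 𝔔' ∩ S₀` and
`J ∩ S₀ = (x_I)L ∩ S₀`. [folklore] -/
theorem comap_model_eq {e : 𝒮 0} (L : Type u) [CommRing L] [Algebra S L]
    [IsLocalization (Submonoid.powers (e : S)) L]
    (R₀ : Type u) [CommRing R₀] [Algebra (𝒮 0) R₀] [Algebra R₀ L]
    (hcomm : ∀ c : 𝒮 0, algebraMap R₀ L (algebraMap (𝒮 0) R₀ c) = algebraMap S L (c : S))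
    (𝔔' : Ideal S) [𝔔'.IsPrime] (he𝔔 : (e : S) ∉ 𝔔') (IL : Ideal L) :
    ((𝔔'.map (algebraMap S L)).comap (algebraMap R₀ L)).comap (algebraMap (𝒮 0) R₀) =
        𝔔'.comap (algebraMap (𝒮 0) S) ∧
      (IL.comap (algebraMap R₀ L)).comap (algebraMap (𝒮 0) R₀) =
        IL.comap ((algebraMap S L).comp (algebraMap (𝒮 0) S)) := by
  have hφcomp : (algebraMap R₀ L).comp (algebraMap (𝒮 0) R₀) =
      (algebraMap S L).comp (algebraMap (𝒮 0) S) := by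
    ext c
    simp only [RingHom.comp_apply]
    exact hcomm c
  obtain ⟨-, -, hunder⟩ := isPrime_map_and_le L ⊥ 𝔔' he𝔔 bot_le
  refine ⟨?_, ?_⟩
  · rw [Ideal.comap_comap, hφcomp, ← Ideal.comap_comap, hunder]
  · rw [Ideal.comap_comap, hφcomp]

end Summit.ResolutionOfSingularities.ResolutionOfSingularities.Theorems.FRationalResolution.StratumDescentGradeZero

end
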